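import Summits.QuantumAdvantage.QuantumAdvantage.Theorems.SparsityDialMP10

/-!
# SparsityDial — part MP11 of 11 of the «MovingPointers» package (decomp-qadv lens 2, g18): §G GAUGE COVARIANCE — `AffineTableLossG3` / `AffineTableLossSG3` (PROVED)

Imports its predecessor `SparsityDialMP10` (linear chain MP1 → … → MP11); the package overview is the module docstring of `SparsityDialMP1`.
This part: by the tree's stabilizer-gauge law `StabilizerDial.winset_pad` (a padded strategy wins exactly where `P` wins, for EVERY gauge), the
affine-table rung holds AFTER AN ARBITRARY GAUGE — `AffineTableLossG3` (some `s` gives `dev (pad P s) x = S(L x)` on odd inputs; PROVED) and in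
piece S's own gauge-existential shape `AffineTableLossSG3` (admissible gauge of degree `≤ (log₂ n)^{c+1}`; PROVED; below `SparseGenericLoss3` by
name: `tableSG_of_sparse`); the zero-gauge forms of part MP10 are recovered (`table_of_tableG`, `tableS_of_tableSG`).
No `sorry`; standard axioms; no instances / notation.
-/

set_option linter.unusedVariables false
set_option linter.dupNamespace false

noncomputable section
open scoped Classical

namespace Summit.QuantumAdvantage.QuantumAdvantage.Theorems.SparsityDial

open Finset
open Literature.Computability.QuantumComplexity Literature.Computability.QuantumComplexity.RingHLF
open Literature.Computability.MetaComplexity Literature.Computability.MetaComplexity.Smolensky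
open Summit.QuantumAdvantage.AdviceFreeQNC0
open Summit.QuantumAdvantage.QuantumAdvantage.Theorems.HolonomyDial (gCond)
open Summit.QuantumAdvantage.QuantumAdvantage.Theorems.LocusDial
open Summit.QuantumAdvantage.QuantumAdvantage.Theorems.AnchorDial (dev outB win_iff card_odd_ge)
open Summit.QuantumAdvantage.QuantumAdvantage.Theorems.HolonomyDial (card_odd_le)
open Summit.QuantumAdvantage.QuantumAdvantage.Theorems.StabilizerDial (eventually_polylog StabFew stabFew_of_fewLocus)

/-! ## §G  GAUGE COVARIANCE: the affine-table rung holds AFTER AN ARBITRARY GAUGE (`winset_pad`) -/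

section Gauge
variable {N t : ℕ}

open Summit.QuantumAdvantage.QuantumAdvantage.Theorems.StabilizerDial (pad winset_pad outB_pad_zero dev_congr)

/-- **`AffineTableLossG3`** — the GAUGED affine-table rung: it suffices that SOME gauge `s` (any cube functions, no degree
bound needed) turns the deviation sets of `P` into an affine table, `dev (pad P s) x = S(L x)` on odd inputs. -/
def AffineTableLossG3 : Prop := ∃ C : ℕ, ∀ c : ℕ, ∃ n₀ : ℕ, ∀ n ≥ n₀, ∀ t ≤ (Nat.log 2 n) ^ c,
  ∀ (M : Fin t → Fin n → ZMod 3) (S : (Fin t → ZMod 3) → Finset (Fin n)), (∀ v, (S v).card ≤ (Nat.log 2 n) ^ c) →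
    ∀ P : Fin n → CubeFn (ZMod 3) n,
      (∃ s : Fin n → CubeFn (ZMod 3) n, ∀ x, OddZeros x → dev (pad P s) x = S (linHash M x)) →
      ((univ.filter fun x : Fin n → Bool => OddZeros x ∧ Rel x (fun i => decide (P i x = 1))).card : ℝ) ≤
        (1 - 1 / (n : ℝ) ^ C) * (2 : ℝ) ^ (n - 1)

/-- **PROVED** — by the tree's stabilizer-gauge law `winset_pad` (the padded strategy wins exactly where `P` wins) applied to
`affineTableLoss3` for `pad P s`. -/
theorem affineTableLossG3 : AffineTableLossG3 := by
  obtain ⟨C, hC⟩ := affineTableLoss3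
  refine ⟨C, fun c => ?_⟩
  obtain ⟨n₀, hn₀⟩ := hC c
  refine ⟨n₀, fun n hn t ht M S hcard P hs => ?_⟩
  obtain ⟨s, hdev⟩ := hs
  have h := hn₀ n hn t ht M S hcard (pad P s) hdev
  rwa [winset_pad] at h

/-- the gauged rung contains the ungauged one (zero gauge). -/
theorem table_of_tableG (h : AffineTableLossG3) : AffineTableLoss3 := by
  obtain ⟨C, hC⟩ := h
  refine ⟨C, fun c => ?_⟩
  obtain ⟨n₀, hn₀⟩ := hC c
  refine ⟨n₀, fun n hn t ht M S hcard P hdev => hn₀ n hn t ht M S hcard P ⟨fun _ => 0, fun x hx => ?_⟩⟩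
  rw [dev_congr (outB_pad_zero P) x]; exact hdev x hx

/-- **`AffineTableLossSG3`** — piece S's OWN shape: low degree, no cheap one-point normal form, and SOME ADMISSIBLE GAUGE (degree
`≤ (log₂ n)^{c+1}`, exactly the gauge level of S's hypothesis `StabFew _ 0 (c+1)`) makes the deviation sets an affine table. -/
def AffineTableLossSG3 : Prop := ∀ c : ℕ, ∃ C : ℕ, ∃ n₀ : ℕ, ∀ n ≥ n₀, ∀ t ≤ (Nat.log 2 n) ^ c,
  ∀ (M : Fin t → Fin n → ZMod 3) (S : (Fin t → ZMod 3) → Finset (Fin n)), (∀ v, (S v).card ≤ (Nat.log 2 n) ^ c) →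
    ∀ P : Fin n → CubeFn (ZMod 3) n, (∀ i, P i ∈ lowDeg (ZMod 3) n ((Nat.log 2 n) ^ c)) →
      ¬ StabFew 1 0 (c + 1) P →
      (∃ s : Fin n → CubeFn (ZMod 3) n, (∀ i, s i ∈ lowDeg (ZMod 3) n ((Nat.log 2 n) ^ (c + 1))) ∧
        ∀ x, OddZeros x → dev (pad P s) x = S (linHash M x)) →
      ((univ.filter fun x : Fin n → Bool => OddZeros x ∧ Rel x (fun i => decide (P i x = 1))).card : ℝ) ≤
        (1 - 1 / (n : ℝ) ^ C) * (2 : ℝ) ^ (n - 1)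

/-- BY NAME: piece S implies the gauged S-form — the admissible gauge witnesses `StabFew ((log₂ n)^c) 0 (c+1) P` literally. -/
theorem tableSG_of_sparse (hS : SparseGenericLoss3) : AffineTableLossSG3 := by
  intro c
  obtain ⟨C, hC⟩ := hS c
  obtain ⟨n₀, hn₀⟩ := hC c
  refine ⟨C, n₀, fun n hn t ht M S hcard P hdeg hnot hs => ?_⟩
  obtain ⟨s, hsdeg, hdev⟩ := hs
  refine hn₀ n hn P hdeg ⟨s, hsdeg, fewLocus_of_dev_card (pad P s) ?_⟩ hnot
  intro x hx
  rw [hdev x hx]; exact hcard _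

/-- SparsityDial «MovingPointers» helper `tableSG_of_tableG` (decomp-qadv lens-2 g18 land package; see the module docstring). -/
theorem tableSG_of_tableG (h : AffineTableLossG3) : AffineTableLossSG3 := by
  obtain ⟨C, hC⟩ := h
  intro c
  obtain ⟨n₀, hn₀⟩ := hC c
  exact ⟨C, n₀, fun n hn t ht M S hcard P _ _ hs => hn₀ n hn t ht M S hcard P (hs.elim fun s h => ⟨s, h.2⟩)⟩

/-- the gauged S-form contains the zero-gauge S-form of §E. -/
theorem tableS_of_tableSG (h : AffineTableLossSG3) : AffineTableLossS3 := by
  intro c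
  obtain ⟨C, n₀, hn₀⟩ := h c
  refine ⟨C, n₀, fun n hn t ht M S hcard P hdeg hnot hdev => hn₀ n hn t ht M S hcard P hdeg hnot
    ⟨fun _ => 0, fun _ => Submodule.zero_mem _, fun x hx => ?_⟩⟩
  rw [dev_congr (outB_pad_zero P) x]; exact hdev x hx

/-- **S DECIDED on the GAUGE-SATURATED affine-table class: `AffineTableLossSG3` PROVED.** -/
theorem affineTableLossSG3 : AffineTableLossSG3 := tableSG_of_tableG affineTableLossG3

end Gauge

/-- info: 'Summit.QuantumAdvantage.QuantumAdvantage.Theorems.SparsityDial.affineTableLossG3' depends on axioms: [propext,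
 Classical.choice,
 Quot.sound] -/
#guard_msgs in #print axioms affineTableLossG3
/-- info: 'Summit.QuantumAdvantage.QuantumAdvantage.Theorems.SparsityDial.affineTableLossSG3' depends on axioms: [propext,
 Classical.choice,
 Quot.sound] -/
#guard_msgs in #print axioms affineTableLossSG3
/-- info: 'Summit.QuantumAdvantage.QuantumAdvantage.Theorems.SparsityDial.tableSG_of_sparse' depends on axioms: [propext,
 Classical.choice,
 Quot.sound] -/
#guard_msgs in #print axioms tableSG_of_sparse
/-- info: 'Summit.QuantumAdvantage.QuantumAdvantage.Theorems.SparsityDial.tableS_of_tableSG' depends on axioms: [propext,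
 Classical.choice,
 Quot.sound] -/
#guard_msgs in #print axioms tableS_of_tableSG



end Summit.QuantumAdvantage.QuantumAdvantage.Theorems.SparsityDial
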